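import Literature.InformationTheory.QuantumCodes.QuantumExpanderCodes
import Literature.InformationTheory.QuantumCodes.ClusterCountingBound
import Mathlib.Analysis.SpecialFunctions.Pow.Real
import Mathlib.Algebra.Order.Field.GeomSum
import HarnessLib

/-!
# The `α`-percolation union bound (Fawzi–Grospellier–Leverrier 2018 Thm. 17, with the tree's Peierls
# constant): `∑_{E : MaxConn_α(E) ≥ t} μ(E) ≤ |V| Σ_{s ≥ t} Δ^{2(s−1)} (2 p^α)^s`

Topic `Literature/InformationTheory/QuantumCodes` (venture QEC, LADDER-QEC Q5; the percolation input of the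
small-set-flip THRESHOLD theorem FGL18 Thm. 1, in the existential-constants form in which the tree types that
theorem — `FGL18_theorem1_le` asks only for SOME `p₀, C, C' > 0`, so the sharp constant `p_ls` of Thm. 17
(`percolationValue`) is not needed). Source: FGL18 = arXiv:1711.08351v2, Thm. 17 (§4, p0013) and its proof
§7.2 (p0019–p0021): union bound over connected sets `X` of each size `s ≥ t` and over the subsets
`F ⊆ X` with `|F| ≥ α|X|`, local stochasticity `ℙ(F ⊆ E) ≤ p^{|F|}`. This file proves the same bound with
the tree's lattice-animal count `|V|·Δ^{2(s−1)}` (`card_connectedOfCard_le`, ClusterCountingBound.lean) in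
place of FGL's `|V|·K(d)^s` and with the crude `2^s` in place of `2^{s h(α)}`: the α-dense generalisation
(`IsAlphaSubset`, `HasAlphaCluster` of `QuantumExpanderCodes.lean`; `α = 1/2`, `t = d` is the tree's
`HasDenseCluster`) of lit-2's `sum_hasDenseCluster_le(_geometric)`.

* `sum_filter_alphaDense_le` — for a fixed `X`: `∑_{E : α|X| ≤ |X ∩ E|} μ E ≤ (2 p^α)^{|X|}`;
* `sum_hasAlphaCluster_le` — the union bound `≤ Σ_{s=t}^{|V|} |V| Δ^{2(s−1)} (2p^α)^s`;
* `sum_hasAlphaCluster_le_geometric` — if `r := 2Δ² p^α < 1`: `≤ |V| r^t / (Δ²(1 − r))`, i.e. the shape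
  `C·|V|·(p/p₀)^{αt}` with `p₀ = (2Δ²)^{−1/α}` (a WEAKER constant than FGL's `p_ls`; only constants differ).
-/

namespace Literature.InformationTheory.QuantumCodes

open Finset Literature.Probability.LatticeModels

variable {V : Type*} [Fintype V] [DecidableEq V]

section AlphaClusters

variable (G : SimpleGraph V) [DecidableRel G.Adj]

/-- Sums over a union of events are at most the sum of the sums (nonnegative weights). [folklore] -/
private theorem sum_biUnion_le_sum' {ι β : Type*} [DecidableEq β] (T : Finset ι) (B : ι → Finset β)
    (W : β → ℝ) (hW : ∀ b, 0 ≤ W b) : ∑ b ∈ T.biUnion B, W b ≤ ∑ a ∈ T, ∑ b ∈ B a, W b := by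
  classical
  induction T using Finset.induction_on with
  | empty => simp
  | insert a T ha ih =>
    rw [Finset.biUnion_insert, Finset.sum_insert ha]
    have hu : ∑ b ∈ B a ∪ T.biUnion B, W b ≤ ∑ b ∈ B a, W b + ∑ b ∈ T.biUnion B, W b := by
      rw [← Finset.sum_union_inter]
      have : 0 ≤ ∑ b ∈ B a ∩ T.biUnion B, W b := sum_nonneg fun b _ => hW b
      linarith
    linarith

variable {G}

/-- **Weight of "a FIXED set `X` is an `α`-subset of `E`"** under a locally stochastic weight of parameter
`p ∈ [0,1]`: `∑_{E : α|X| ≤ |X ∩ E|} μ E ≤ (2 p^α)^{|X|}` — at most `2^{|X|}` subsets `F ⊆ X` with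
`|F| ≥ α|X|`, each of weight `ℙ(F ⊆ E) ≤ p^{|F|} ≤ (p^α)^{|X|}`.
[cite: FawziGrospellierLeverrier2018, Thm 17 proof (§7.2, arXiv v2 p0019-p0020: union over F ⊆ X with |F| ≥ α|X|, local stochasticity)] -/
theorem sum_filter_alphaDense_le {μ : Finset V → ℝ} {p : ℝ} (hμ : IsLocallyStochastic μ p) (hp0 : 0 ≤ p)
    (hp1 : p ≤ 1) {α : ℝ} (hα0 : 0 < α) (X : Finset V) [DecidablePred fun E : Finset V => IsAlphaSubset α E X] :
    ∑ E ∈ univ.filter (fun E => IsAlphaSubset α E X), μ E ≤ (2 * p ^ α) ^ X.card := by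
  classical
  set big : Finset (Finset V) := X.powerset.filter fun F => α * X.card ≤ (F.card : ℝ) with hbig
  have hcover : univ.filter (fun E => IsAlphaSubset α E X) ⊆
      big.biUnion fun F => univ.filter fun E => F ⊆ E := by
    intro E hE
    rw [Finset.mem_filter] at hE
    rw [Finset.mem_biUnion]
    refine ⟨X ∩ E, ?_, ?_⟩
    · rw [hbig, Finset.mem_filter, Finset.mem_powerset]
      exact ⟨Finset.inter_subset_left, hE.2⟩
    · rw [Finset.mem_filter]
      exact ⟨Finset.mem_univ _, Finset.inter_subset_right⟩
  have hpa0 : 0 ≤ p ^ α := Real.rpow_nonneg hp0 α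
  have hstep1 : ∑ E ∈ univ.filter (fun E => IsAlphaSubset α E X), μ E ≤
      ∑ F ∈ big, ∑ E ∈ univ.filter (fun E => F ⊆ E), μ E :=
    (Finset.sum_le_sum_of_subset_of_nonneg hcover fun E _ _ => hμ.nonneg E).trans
      (sum_biUnion_le_sum' big _ μ hμ.nonneg)
  have hstep2 : ∀ F ∈ big, ∑ E ∈ univ.filter (fun E => F ⊆ E), μ E ≤ (p ^ α) ^ X.card := by
    intro F hF
    rw [hbig, Finset.mem_filter, Finset.mem_powerset] at hF
    refine (hμ.sum_filter_superset_le F).trans ?_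
    -- `p^{|F|} ≤ (p^α)^{|X|}` since `|F| ≥ α|X|` and `p ≤ 1`
    rw [← Real.rpow_natCast p F.card, ← Real.rpow_natCast (p ^ α) X.card, ← Real.rpow_mul hp0]
    rcases hp0.lt_or_eq with hp | hp
    · exact Real.rpow_le_rpow_of_exponent_ge hp hp1 hF.2
    · -- `p = 0`
      rw [← hp]
      by_cases hF0 : (F.card : ℝ) = 0
      · have hX0 : α * (X.card : ℝ) ≤ 0 := by rw [← hF0]; exact hF.2
        have hX : (X.card : ℝ) = 0 := by
          have := Nat.cast_nonneg (α := ℝ) X.card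
          nlinarith
        rw [hF0, hX, mul_zero]
      · rw [Real.zero_rpow hF0]
        exact Real.rpow_nonneg le_rfl _
  have hstep3 : ∑ F ∈ big, ∑ E ∈ univ.filter (fun E => F ⊆ E), μ E ≤ (big.card : ℝ) * (p ^ α) ^ X.card := by
    refine (Finset.sum_le_sum hstep2).trans ?_
    rw [Finset.sum_const, nsmul_eq_mul]
  have hbig_card : (big.card : ℝ) ≤ (2 : ℝ) ^ X.card := by
    have h1 : big.card ≤ X.powerset.card := Finset.card_filter_le _ _
    rw [Finset.card_powerset] at h1
    exact_mod_cast h1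
  calc ∑ E ∈ univ.filter (fun E => IsAlphaSubset α E X), μ E
      ≤ (big.card : ℝ) * (p ^ α) ^ X.card := hstep1.trans hstep3
    _ ≤ (2 : ℝ) ^ X.card * (p ^ α) ^ X.card := mul_le_mul_of_nonneg_right hbig_card (pow_nonneg hpa0 _)
    _ = (2 * p ^ α) ^ X.card := by rw [mul_pow]

/-- **The `α`-percolation union bound** (FGL18 Thm. 17 with the tree's lattice-animal constant): in a
finite graph with degrees `≤ Δ`, for a locally stochastic weight of parameter `p ∈ [0,1]`, `0 < α`, `1 ≤ t`,
`∑_{E : MaxConn_α(E) ≥ t} μ E ≤ Σ_{s=t}^{|V|} |V| Δ^{2(s−1)} (2p^α)^s`.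
[cite: FawziGrospellierLeverrier2018, Thm 17 eq. (problc) and its proof (§7.2, arXiv v2 p0019-p0021), with Cor 28 replaced by the Peierls count] -/
theorem sum_hasAlphaCluster_le {Δ : ℕ} (hΔ : ∀ x, G.degree x ≤ Δ) {μ : Finset V → ℝ} {p : ℝ}
    (hμ : IsLocallyStochastic μ p) (hp0 : 0 ≤ p) (hp1 : p ≤ 1) {α : ℝ} (hα0 : 0 < α) {t : ℕ}
    (ht : 1 ≤ t) [DecidablePred (HasAlphaCluster G α t)] :
    ∑ E ∈ univ.filter (fun E => HasAlphaCluster G α t E), μ E ≤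
      ∑ s ∈ Finset.Icc t (Fintype.card V),
        (Fintype.card V : ℝ) * (Δ : ℝ) ^ (2 * (s - 1)) * (2 * p ^ α) ^ s := by
  classical
  set clusters : Finset (Finset V) :=
    (Finset.Icc t (Fintype.card V)).biUnion fun s => connectedOfCard G s with hclusters
  have hmem : ∀ {s : ℕ} {S : Finset V}, S ∈ connectedOfCard G s ↔ S.card = s ∧ IsGraphConnected G S := by
    intro s S; simp [connectedOfCard]
  have hcover : univ.filter (fun E => HasAlphaCluster G α t E) ⊆
      clusters.biUnion fun X => univ.filter fun E => IsAlphaSubset α E X := by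
    intro E hE
    rw [Finset.mem_filter] at hE
    obtain ⟨X, hXconn, htX, hXE⟩ := hE.2
    rw [Finset.mem_biUnion]
    refine ⟨X, ?_, Finset.mem_filter.2 ⟨Finset.mem_univ _, hXE⟩⟩
    rw [hclusters, Finset.mem_biUnion]
    exact ⟨X.card, Finset.mem_Icc.2 ⟨htX, Finset.card_le_univ X⟩, hmem.2 ⟨rfl, hXconn⟩⟩
  have h1 : ∑ E ∈ univ.filter (fun E => HasAlphaCluster G α t E), μ E ≤
      ∑ X ∈ clusters, ∑ E ∈ univ.filter (fun E => IsAlphaSubset α E X), μ E :=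
    (Finset.sum_le_sum_of_subset_of_nonneg hcover fun E _ _ => hμ.nonneg E).trans
      (sum_biUnion_le_sum' clusters _ μ hμ.nonneg)
  have h2 : ∑ X ∈ clusters, ∑ E ∈ univ.filter (fun E => IsAlphaSubset α E X), μ E ≤
      ∑ X ∈ clusters, (2 * p ^ α) ^ X.card :=
    Finset.sum_le_sum fun X _ => sum_filter_alphaDense_le hμ hp0 hp1 hα0 X
  have hr0 : 0 ≤ 2 * p ^ α := mul_nonneg zero_le_two (Real.rpow_nonneg hp0 α)
  have h3 : ∑ X ∈ clusters, (2 * p ^ α) ^ X.card ≤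
      ∑ s ∈ Finset.Icc t (Fintype.card V), ∑ X ∈ connectedOfCard G s, (2 * p ^ α) ^ X.card := by
    rw [hclusters]
    exact sum_biUnion_le_sum' _ _ _ fun X => pow_nonneg hr0 _
  have h4 : ∀ s ∈ Finset.Icc t (Fintype.card V),
      ∑ X ∈ connectedOfCard G s, (2 * p ^ α) ^ X.card ≤
        (Fintype.card V : ℝ) * (Δ : ℝ) ^ (2 * (s - 1)) * (2 * p ^ α) ^ s := by
    intro s hs
    have hs1 : 1 ≤ s := ht.trans (Finset.mem_Icc.1 hs).1
    have hconst : ∑ X ∈ connectedOfCard G s, (2 * p ^ α) ^ X.card =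
        ((connectedOfCard G s).card : ℝ) * (2 * p ^ α) ^ s := by
      rw [Finset.sum_congr rfl fun X hX => by rw [(hmem.1 hX).1], Finset.sum_const, nsmul_eq_mul]
    rw [hconst]
    refine mul_le_mul_of_nonneg_right ?_ (pow_nonneg hr0 _)
    exact_mod_cast card_connectedOfCard_le hΔ hs1
  exact h1.trans (h2.trans (h3.trans (Finset.sum_le_sum h4)))

/-- **Geometric form of the `α`-percolation bound**: if `1 ≤ Δ`, `1 ≤ t` and `r := 2Δ² p^α < 1`, then
`∑_{E : MaxConn_α(E) ≥ t} μ E ≤ |V| · r^t / (Δ² (1 − r))` — exponentially small in `t` (`= C|V|(p/p₀)^{αt}`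
with `p₀ = (2Δ²)^{-1/α}`, the shape of FGL18 Thm 17 eq. (problc) with a weaker constant).
[cite: FawziGrospellierLeverrier2018, Thm 17 eq. (problc) (§4, arXiv v2 p0013), weaker constant] -/
theorem sum_hasAlphaCluster_le_geometric {Δ : ℕ} (hΔ : ∀ x, G.degree x ≤ Δ) (hΔ1 : 1 ≤ Δ)
    {μ : Finset V → ℝ} {p : ℝ} (hμ : IsLocallyStochastic μ p) (hp0 : 0 ≤ p) (hp1 : p ≤ 1) {α : ℝ}
    (hα0 : 0 < α) {t : ℕ} (ht : 1 ≤ t) [DecidablePred (HasAlphaCluster G α t)]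
    (hr : 2 * (Δ : ℝ) ^ 2 * p ^ α < 1) :
    ∑ E ∈ univ.filter (fun E => HasAlphaCluster G α t E), μ E ≤
      (Fintype.card V : ℝ) * (2 * (Δ : ℝ) ^ 2 * p ^ α) ^ t /
        ((Δ : ℝ) ^ 2 * (1 - 2 * (Δ : ℝ) ^ 2 * p ^ α)) := by
  classical
  set r : ℝ := 2 * (Δ : ℝ) ^ 2 * p ^ α with hrdef
  have hpa0 : 0 ≤ p ^ α := Real.rpow_nonneg hp0 α
  have hr0 : 0 ≤ r := by rw [hrdef]; positivity
  have hΔpos : (0 : ℝ) < (Δ : ℝ) ^ 2 := by positivity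
  have hn0 : (0 : ℝ) ≤ Fintype.card V := Nat.cast_nonneg _
  refine (sum_hasAlphaCluster_le hΔ hμ hp0 hp1 hα0 ht).trans ?_
  have hterm : ∀ s ∈ Finset.Icc t (Fintype.card V),
      (Fintype.card V : ℝ) * (Δ : ℝ) ^ (2 * (s - 1)) * (2 * p ^ α) ^ s =
        (Fintype.card V : ℝ) / (Δ : ℝ) ^ 2 * r ^ s := by
    intro s hs
    have hs1 : 1 ≤ s := ht.trans (Finset.mem_Icc.1 hs).1
    obtain ⟨u, rfl⟩ : ∃ u, s = u + 1 := ⟨s - 1, by omega⟩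
    simp only [Nat.add_sub_cancel, hrdef]
    field_simp
    ring
  rw [Finset.sum_congr rfl hterm, ← Finset.mul_sum]
  have hgeom : ∑ s ∈ Finset.Icc t (Fintype.card V), r ^ s ≤ r ^ t / (1 - r) := by
    have hIcc : Finset.Icc t (Fintype.card V) = Finset.Ico t (Fintype.card V + 1) := by
      ext s; simp only [Finset.mem_Icc, Finset.mem_Ico]; omega
    rw [hIcc]
    exact geom_sum_Ico_le_of_lt_one hr0 hr
  calc (Fintype.card V : ℝ) / (Δ : ℝ) ^ 2 * ∑ s ∈ Finset.Icc t (Fintype.card V), r ^ s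
      ≤ (Fintype.card V : ℝ) / (Δ : ℝ) ^ 2 * (r ^ t / (1 - r)) :=
        mul_le_mul_of_nonneg_left hgeom (div_nonneg hn0 hΔpos.le)
    _ = (Fintype.card V : ℝ) * r ^ t / ((Δ : ℝ) ^ 2 * (1 - r)) := by
        rw [div_mul_div_comm]

end AlphaClusters

end Literature.InformationTheory.QuantumCodes
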